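import Summits.NavierStokesRegularity.NavierStokesRegularity.Theorems.StrainDoorsRecordIdentity
import HarnessLib

/-!
# Strain doors, PART K — peak doors (ROUND 59 of the ns-regularity-ideate cell)

The record identity (PART J) names the slack of the record law at an attained record: the scale-free viscous
CONCAVITY `(T − t̄)ν(−Δ|ω|)(x̄)/|ω(x̄)| ≥ 0` of the vorticity magnitude at its peak.  This file types the objects on
which the programme's hard core now sits:

* §K1 the TYPE-I TANGENT PEAK class `IsTypeITangentPeak C₀ v z̄` (continuous, Type-I, bounded-weak ancient,
  vorticity number attained at `(−1, z̄)` with `ω_v(−1,z̄) ≠ 0`); every classical Type-I solution with `ω ≢ 0`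
  has a tangent field in it (`isTypeITangentPeak_of_typeI`, PART H), and the record identity holds on it
  (`IsTypeITangentPeak.record_identity`, PART I/J engines);
* §K2 four typed DOORS on the class — «PeakConcavityFloor» (geometric), «PeakTwistFloor» (geometric),
  «PeakStretchingCap» (dynamic), «PeakClassEmpty» (the Liouville statement itself) — none proved here;
* §K3 floor + cap (same constant) ⇒ «PeakClassEmpty» (by the identity, resp. by the law alone);
* §K4 «PeakClassEmpty» ⇒ every classical Type-I solution on `(−∞,0)` is irrotational, hence (curl-free
  Liouville, KNSS Lemma 3.1, + Type-I decay) VANISHES IDENTICALLY; and the pinch of PART J read on the class: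
  a twist floor `κ > 0` bounds the peak height, `ρ̄ ≤ K₃(C₀)/κ`.

References: Koch–Nadirashvili–Seregin–Šverák, Acta Math. 203 (2009), Lemma 3.1, §4–§6 [KNSS2009];
Constantin–Fefferman, Indiana Univ. Math. J. 42 (1993); Grujić, Comm. Math. Phys. 290 (2009).
-/

noncomputable section

open MeasureTheory Set Function Filter Metric Real InnerProductSpace
open _root_.Topology
open scoped ENNReal NNReal RealInnerProductSpace ContDiff Laplacian
open Literature.Analysis Literature.Analysis.FluidPDE
open Literature.Analysis.FluidPDE.VorticityDirectionDynamics

set_option linter.unusedVariables false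
set_option linter.unusedSectionVars false

namespace Summit.NavierStokesRegularity.NavierStokesRegularity.Theorems.StrainDoors

open Summit.NavierStokesRegularity.NavierStokesRegularity.Theorems.ArgmaxDoors

/-! # PART K — PEAK DOORS (ROUND 60)

The record identity (PART J) names the slack of the record law: `ν(T − t̄)(−Δ|ω|)(x̄)/|ω(x̄)| ≥ 0`, the viscous
CONCAVITY of the vorticity magnitude at its peak.  On the TYPE-I TANGENT PEAK class (the tangent fields of
classical Type-I solutions at their attained vorticity record, §K1) the programme's hard core therefore splits
into two typed doors at ONE point: a GEOMETRIC floor on the peak concavity (or on the twist) and a DYNAMIC cap on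
the stretching rate, with the same constant; together they exclude the class (`§K3`), i.e. give the Type-I
Liouville theorem `u ≡ 0` for classical Type-I solutions (`§K4`).  Nothing here proves either door. -/

/-! ## §K1 The Type-I tangent peak class -/

/-- **The TYPE-I TANGENT PEAK class** `IsTypeITangentPeak C₀ v z̄`: `v` is continuous, Type-I with constant `C₀`
on `t ≤ −1/4`, `t ↦ v(t − 1/4)` is a bounded-weak ancient Navier–Stokes solution (`ν = 1`), `ω_v(−1, z̄) ≠ 0`,
and the vorticity number of `v` is ATTAINED at `(−1, z̄)`: `(0 − s)|ω_v(s,y)| ≤ (0 − (−1))|ω_v(−1,z̄)|` for all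
`s ≤ −1/4`, `y`.  PART H/I/J show: every classical Type-I solution with `ω ≢ 0` has a tangent field in this class
(`isTypeITangentPeak_of_typeI`), and on the class the slices are smooth, the vorticity equation holds pointwise and
the record identity holds (`IsTypeITangentPeak.record_identity`). -/
def IsTypeITangentPeak (C₀ : ℝ) (v : ℝ → (EuclideanSpace ℝ (Fin 3)) → (EuclideanSpace ℝ (Fin 3)))
    (zbar : EuclideanSpace ℝ (Fin 3)) : Prop :=
  Continuous (uncurry v) ∧
  (∀ t ≤ -(1/4 : ℝ), ∀ x, ‖v t x‖ ≤ C₀ / (‖x‖ + √(-t))) ∧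
  IsBoundedWeakNSSolutionOn (Iio 0) isOpen_Iio 1 (fun t => v (t - 1/4)) ∧
  curl (v (-1)) zbar ≠ 0 ∧
  (∀ s ≤ -(1/4 : ℝ), ∀ y, (0 - s) * ‖curl (v s) y‖ ≤ (0 - (-1)) * ‖curl (v (-1)) zbar‖)

/-- ★★ **Every classical Type-I solution with `ω ≢ 0` has a tangent field in the peak class**, obtained along
Navier–Stokes rescalings `λ_j u(λ_j²·, λ_j·)` converging with gradients and curls, and majorising the vorticity
number of `u`: `(0 − s)|ω_u(s,y)| ≤ (0 − (−1))|ω_v(−1,z̄)|` for all `s < 0`. [new-as-typed; PART H/I] -/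
theorem isTypeITangentPeak_of_typeI {C₀ : ℝ}
    {u : ℝ → (EuclideanSpace ℝ (Fin 3)) → (EuclideanSpace ℝ (Fin 3))} {p : ℝ → (EuclideanSpace ℝ (Fin 3)) → ℝ}
    (hsol : IsClassicalNSSolutionOn (Iio 0) 1 0 u p) (hI : HasTypeIDecay C₀ u)
    (hcurl : ∃ t₀ : ℝ, t₀ < 0 ∧ ∃ x₀ : EuclideanSpace ℝ (Fin 3), curl (u t₀) x₀ ≠ 0) :
    ∃ (v : ℝ → (EuclideanSpace ℝ (Fin 3)) → (EuclideanSpace ℝ (Fin 3))) (zbar : EuclideanSpace ℝ (Fin 3)),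
      IsTypeITangentPeak C₀ v zbar ∧
      (∀ s : ℝ, s < 0 → ∀ y, (0 - s) * ‖curl (u s) y‖ ≤ (0 - (-1)) * ‖curl (v (-1)) zbar‖) ∧
      ∃ lam : ℕ → ℝ, (∀ j, 0 < lam j) ∧ ∀ t ≤ -(1/4 : ℝ), ∀ x,
          Tendsto (fun j => nsRescale (lam j) u t x) atTop (𝓝 (v t x)) ∧
          Tendsto (fun j => fderiv ℝ (nsRescale (lam j) u t) x) atTop (𝓝 (fderiv ℝ (v t) x)) ∧
          Tendsto (fun j => curl (nsRescale (lam j) u t) x) atTop (𝓝 (curl (v t) x)) := by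
  obtain ⟨v, zbar, hvc, hlam, hTypeI, hweak, -, -, hne, hnum, hnumv, -⟩ :=
    typeI_tangent_record_identity hsol hI hcurl
  exact ⟨v, zbar, ⟨hvc, hTypeI, hweak, hne, hnumv⟩, hnum, hlam⟩

/-- ★★ **The record identity on the peak class.**  For `(v, z̄)` in the Type-I tangent peak class: the slice
`v(−1)` is smooth, `|ω_v(−1,·)| ≤ |ω_v(−1,z̄)|` everywhere, and with `ρ̄ = |ω_v(−1,z̄)|`, `ξ̄`, `ᾱ = ⟪ξ̄, ∇v(−1,z̄)ξ̄⟫`,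
`F = |∇ξ̄|²_F`, `L = Δ|ω_v(−1,·)|(z̄) ≤ 0`:  `(0 − (−1))(ᾱ − F) = 1 + (0 − (−1))(−L)/ρ̄` and
`(0 − (−1))ᾱ = 1 + (0 − (−1))(−⟪ξ̄, Δω_v(−1,z̄)⟫)/ρ̄`, `ρ̄F ≤ −⟪ξ̄, Δω_v(−1,z̄)⟫`. [new-as-typed; PART I/J engines] -/
theorem IsTypeITangentPeak.record_identity {C₀ : ℝ}
    {v : ℝ → (EuclideanSpace ℝ (Fin 3)) → (EuclideanSpace ℝ (Fin 3))} {zbar : EuclideanSpace ℝ (Fin 3)}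
    (h : IsTypeITangentPeak C₀ v zbar) :
    ContDiff ℝ ∞ (v (-1)) ∧
    (∀ y, ‖curl (v (-1)) y‖ ≤ ‖curl (v (-1)) zbar‖) ∧
    (Δ fun y => ‖curl (v (-1)) y‖) zbar ≤ 0 ∧
    (0 - (-1)) * (⟪vorticityDirection (curl (v (-1))) zbar,
          fderiv ℝ (v (-1)) zbar (vorticityDirection (curl (v (-1))) zbar)⟫ -
        frobeniusNormSq (fderiv ℝ (vorticityDirection (curl (v (-1)))) zbar)) =
      1 + (0 - (-1)) * (-(Δ fun y => ‖curl (v (-1)) y‖) zbar) / ‖curl (v (-1)) zbar‖ ∧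
    (0 - (-1)) * ⟪vorticityDirection (curl (v (-1))) zbar,
          fderiv ℝ (v (-1)) zbar (vorticityDirection (curl (v (-1))) zbar)⟫ =
      1 + (0 - (-1)) * (-⟪vorticityDirection (curl (v (-1))) zbar, (Δ (curl (v (-1)))) zbar⟫) /
        ‖curl (v (-1)) zbar‖ ∧
    ‖curl (v (-1)) zbar‖ * frobeniusNormSq (fderiv ℝ (vorticityDirection (curl (v (-1)))) zbar) ≤
      -⟪vorticityDirection (curl (v (-1))) zbar, (Δ (curl (v (-1)))) zbar⟫ := by
  obtain ⟨hvc, hTypeI, hweak, hne, hnumv⟩ := h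
  have hρ : 0 < ‖curl (v (-1)) zbar‖ := norm_pos_iff.mpr hne
  have hmaxX : ∀ y, ‖curl (v (-1)) y‖ ≤ ‖curl (v (-1)) zbar‖ := fun y => by
    have h := hnumv (-1) (by norm_num) y
    linarith
  have hrec : IsLocalMax (fun s => (0 - s) * ‖curl (v s) zbar‖) (-1) := by
    show ∀ᶠ s in 𝓝 (-1 : ℝ), (0 - s) * ‖curl (v s) zbar‖ ≤ (0 - (-1)) * ‖curl (v (-1)) zbar‖
    filter_upwards [Iic_mem_nhds (show (-1 : ℝ) < -(1/4 : ℝ) by norm_num)] with s hs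
    exact hnumv s hs zbar
  obtain ⟨hsm, hD⟩ := tangent_vorticity_eq hvc hTypeI hweak (by norm_num : (-1:ℝ) ≤ -(1/2 : ℝ)) zbar
  have heq : ((Δ (curl (v (-1)))) zbar - fderiv ℝ (curl (v (-1))) zbar (v (-1) zbar) +
        fderiv ℝ (v (-1)) zbar (curl (v (-1)) zbar)) + convect (v (-1)) (curl (v (-1))) zbar =
      convect (curl (v (-1))) (v (-1)) zbar + (1 : ℝ) • (Δ (curl (v (-1)))) zbar := by
    simp only [convect_apply, one_smul]; abel
  obtain ⟨h1, hlap⟩ := inner_vorticity_rhs_eq_at_argmax 1 hsm hmaxX hne heq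
  obtain ⟨h2, -⟩ := fermat_two_sided_of_hasDerivAt hD (by norm_num : (-1 : ℝ) < 0) hrec
  have hom2 : ContDiffAt ℝ 2 (curl (v (-1))) zbar :=
    (contDiff_infty.mp (contDiff_curl (n := ⊤)
      (hsm.of_le (by exact_mod_cast (le_top : (⊤ + 1 : ℕ∞) ≤ ⊤)))) 2).contDiffAt
  have hLap := laplacian_norm_eq hom2 hne
  obtain ⟨ρ, hρdef⟩ : ∃ ρ : ℝ, ρ = ‖curl (v (-1)) zbar‖ := ⟨_, rfl⟩
  obtain ⟨F, hFdef⟩ : ∃ F : ℝ, F = frobeniusNormSq (fderiv ℝ (vorticityDirection (curl (v (-1)))) zbar) :=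
    ⟨_, rfl⟩
  obtain ⟨G, hGdef⟩ : ∃ G : ℝ, G = ⟪vorticityDirection (curl (v (-1))) zbar, (Δ (curl (v (-1)))) zbar⟫ :=
    ⟨_, rfl⟩
  obtain ⟨a, hadef⟩ : ∃ a : ℝ, a = ⟪vorticityDirection (curl (v (-1))) zbar,
      fderiv ℝ (v (-1)) zbar (vorticityDirection (curl (v (-1))) zbar)⟫ := ⟨_, rfl⟩
  obtain ⟨L, hLdef⟩ : ∃ L : ℝ, L = (Δ fun y => ‖curl (v (-1)) y‖) zbar := ⟨_, rfl⟩
  rw [← hρdef] at hρ hLap h1 h2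
  rw [← hFdef, ← hadef, ← hLdef, one_mul] at h1
  rw [← hFdef, ← hGdef, ← hLdef] at hLap
  rw [← hLdef] at hlap
  -- `ρ² = (0+1)((a − F)ρ² + ρL)` ⇒ `ρ = (0+1)((a − F)ρ + L)`
  have e : ρ ^ 2 = (0 - (-1)) * ((a - F) * ρ ^ 2 + 1 * ρ * L) := by
    have h := h2; rw [h1] at h; exact h
  have key : ρ * ρ = ρ * ((0 - (-1)) * ((a - F) * ρ + 1 * L)) := by nlinarith [e]
  have key' := mul_left_cancel₀ hρ.ne' key
  have hid : (0 - (-1)) * (a - F) = 1 + (0 - (-1)) * -L / ρ := by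
    have hX : (0 - (-1)) * -L / ρ = (0 - (-1)) * (a - F) - 1 := by
      rw [div_eq_iff hρ.ne']; linear_combination key'
    linarith [hX]
  have hid' : (0 - (-1)) * a = 1 + (0 - (-1)) * -G / ρ := by
    have e2 : (0 - (-1)) * -G / ρ = (0 - (-1)) * a - 1 := by
      rw [div_eq_iff hρ.ne']
      have e1 : (0 - (-1)) * -L = ((0 - (-1)) * (a - F) - 1) * ρ := by
        have h := hid
        have : (0 - (-1)) * -L / ρ = (0 - (-1)) * (a - F) - 1 := by linarith [h]
        rwa [div_eq_iff hρ.ne'] at this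
      linear_combination e1 + hLap
    linarith [e2]
  have hii : ρ * F ≤ -G := by linarith [hLap, hlap]
  subst hρdef hFdef hGdef hadef hLdef
  exact ⟨hsm, hmaxX, hlap, hid, hid', hii⟩

/-! ## §K2 The peak doors -/

/-- door K-α «PeakConcavityFloor» `(C₀, κ)`: on the Type-I tangent peak class with constant `C₀`, the vorticity
magnitude is UNIFORMLY STRICTLY CONCAVE at its peak in the scale-free sense:
`κ ≤ (−Δ|ω_v(−1,·)|)(z̄) / |ω_v(−1,z̄)|`.  (GEOMETRIC: a statement about one smooth slice at one point; vacuous if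
the class is empty.)  Not proved here. -/
def PeakConcavityFloor (C₀ κ : ℝ) : Prop :=
  ∀ (v : ℝ → (EuclideanSpace ℝ (Fin 3)) → (EuclideanSpace ℝ (Fin 3))) (zbar : EuclideanSpace ℝ (Fin 3)),
    IsTypeITangentPeak C₀ v zbar →
      κ ≤ (-(Δ fun y => ‖curl (v (-1)) y‖) zbar) / ‖curl (v (-1)) zbar‖

/-- door K-β «PeakTwistFloor» `(C₀, κ)`: on the class, the vorticity direction has TWIST at least `κ` at the peak:
`κ ≤ |∇ξ_v(−1,z̄)|²_F`.  Not proved here. -/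
def PeakTwistFloor (C₀ κ : ℝ) : Prop :=
  ∀ (v : ℝ → (EuclideanSpace ℝ (Fin 3)) → (EuclideanSpace ℝ (Fin 3))) (zbar : EuclideanSpace ℝ (Fin 3)),
    IsTypeITangentPeak C₀ v zbar →
      κ ≤ frobeniusNormSq (fderiv ℝ (vorticityDirection (curl (v (-1)))) zbar)

/-- door K-γ «PeakStretchingCap» `(C₀, κ)`: on the class, the stretching rate at the peak stays STRICTLY below the
clock rate plus `κ`: `(0 − (−1))·⟪ξ̄, ∇v(−1,z̄)ξ̄⟫ < 1 + (0 − (−1))κ`.  (DYNAMIC.)  Not proved here. -/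
def PeakStretchingCap (C₀ κ : ℝ) : Prop :=
  ∀ (v : ℝ → (EuclideanSpace ℝ (Fin 3)) → (EuclideanSpace ℝ (Fin 3))) (zbar : EuclideanSpace ℝ (Fin 3)),
    IsTypeITangentPeak C₀ v zbar →
      (0 - (-1)) * ⟪vorticityDirection (curl (v (-1))) zbar,
          fderiv ℝ (v (-1)) zbar (vorticityDirection (curl (v (-1))) zbar)⟫ < 1 + (0 - (-1)) * κ

/-- door K-δ «PeakClassEmpty» `(C₀)`: the Type-I tangent peak class with constant `C₀` is EMPTY — the typed form of
the Liouville statement the programme needs (KNSS-type, for the vorticity of tangent fields).  Not proved here. -/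
def PeakClassEmpty (C₀ : ℝ) : Prop :=
  ∀ (v : ℝ → (EuclideanSpace ℝ (Fin 3)) → (EuclideanSpace ℝ (Fin 3))) (zbar : EuclideanSpace ℝ (Fin 3)),
    ¬ IsTypeITangentPeak C₀ v zbar

/-! ## §K3 Compositions: floor + cap ⇒ the class is empty -/

/-- **Concavity floor + stretching cap (same `κ`) ⇒ the peak class is empty**: the record identity gives
`(0+1)ᾱ = 1 + (0+1)F + (0+1)(−L)/ρ̄ ≥ 1 + (0+1)κ`, contradicting the cap. -/
theorem peakClassEmpty_of_concavityFloor_of_cap {C₀ κ : ℝ}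
    (hfl : PeakConcavityFloor C₀ κ) (hcap : PeakStretchingCap C₀ κ) : PeakClassEmpty C₀ := by
  intro v zbar h
  obtain ⟨-, -, -, hid, -, -⟩ := h.record_identity
  have hF := frobeniusNormSq_nonneg (fderiv ℝ (vorticityDirection (curl (v (-1)))) zbar)
  have h1 := hfl v zbar h
  have h2 := hcap v zbar h
  have e : (0 - (-1)) * (-(Δ fun y => ‖curl (v (-1)) y‖) zbar) / ‖curl (v (-1)) zbar‖ =
      (0 - (-1)) * ((-(Δ fun y => ‖curl (v (-1)) y‖) zbar) / ‖curl (v (-1)) zbar‖) := by ring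
  nlinarith [hid, h1, h2, hF, e]

/-- **Twist floor + stretching cap (same `κ`) ⇒ the peak class is empty**: the record LAW alone gives
`(0+1)ᾱ ≥ 1 + (0+1)F ≥ 1 + (0+1)κ`. -/
theorem peakClassEmpty_of_twistFloor_of_cap {C₀ κ : ℝ}
    (hfl : PeakTwistFloor C₀ κ) (hcap : PeakStretchingCap C₀ κ) : PeakClassEmpty C₀ := by
  intro v zbar h
  obtain ⟨-, -, hlap, hid, -, -⟩ := h.record_identity
  have hρ : 0 < ‖curl (v (-1)) zbar‖ := norm_pos_iff.mpr h.2.2.2.1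
  have h1 := hfl v zbar h
  have h2 := hcap v zbar h
  have hq : 0 ≤ (0 - (-1)) * (-(Δ fun y => ‖curl (v (-1)) y‖) zbar) / ‖curl (v (-1)) zbar‖ :=
    div_nonneg (by linarith [hlap]) hρ.le
  nlinarith [hid, h1, h2, hq]

/-! ## §K4 Consumers: an empty peak class is the Type-I Liouville theorem -/

/-- ★★ **PEAK CLASS EMPTY ⇒ TYPE-I SOLUTIONS ARE IRROTATIONAL**: every classical solution on `(−∞,0)` (`ν = 1`,
`f = 0`) with Type-I decay `|u(t,x)| ≤ C₀/(|x| + √(−t))` has `ω ≡ 0` (else PART H–J put its tangent field in the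
class). -/
theorem curl_eq_zero_of_typeI_of_peakClassEmpty {C₀ : ℝ} (hE : PeakClassEmpty C₀)
    {u : ℝ → (EuclideanSpace ℝ (Fin 3)) → (EuclideanSpace ℝ (Fin 3))} {p : ℝ → (EuclideanSpace ℝ (Fin 3)) → ℝ}
    (hsol : IsClassicalNSSolutionOn (Iio 0) 1 0 u p) (hI : HasTypeIDecay C₀ u) :
    ∀ t : ℝ, t < 0 → ∀ x : EuclideanSpace ℝ (Fin 3), curl (u t) x = 0 := by
  by_contra hne
  push Not at hne
  obtain ⟨t₀, ht₀, x₀, hx₀⟩ := hne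
  obtain ⟨v, zbar, hP, -⟩ := isTypeITangentPeak_of_typeI hsol hI ⟨t₀, ht₀, x₀, hx₀⟩
  exact hE v zbar hP

/-- ★★★ **PEAK CLASS EMPTY ⇒ THE TYPE-I LIOUVILLE THEOREM `u ≡ 0`**: an irrotational, divergence-free, bounded
slice is constant (tree `eq_of_curl_eq_zero_of_isDivFree_of_bounded`, KNSS Lemma 3.1), and a constant with Type-I
spatial decay is `0`. Hence: `PeakClassEmpty C₀` ⇒ every classical Type-I solution with constant `C₀` on `(−∞,0)`
VANISHES IDENTICALLY — no Type-I blow-up profile in the class. -/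
theorem eq_zero_of_typeI_of_peakClassEmpty {C₀ : ℝ} (hE : PeakClassEmpty C₀)
    {u : ℝ → (EuclideanSpace ℝ (Fin 3)) → (EuclideanSpace ℝ (Fin 3))} {p : ℝ → (EuclideanSpace ℝ (Fin 3)) → ℝ}
    (hsol : IsClassicalNSSolutionOn (Iio 0) 1 0 u p) (hI : HasTypeIDecay C₀ u) :
    ∀ t : ℝ, t < 0 → ∀ x : EuclideanSpace ℝ (Fin 3), u t x = 0 := by
  intro t ht x
  have hcurl := curl_eq_zero_of_typeI_of_peakClassEmpty hE hsol hI t ht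
  have hs : ContDiff ℝ 2 (u t) :=
    contDiff_infty.mp (hsol.smooth_velocity.contDiff_slice (mem_Iio.mpr ht)) 2
  have hsq : 0 < √(-t) := Real.sqrt_pos.mpr (neg_pos.mpr ht)
  have hC₀ : 0 ≤ C₀ := by
    have h := (norm_nonneg _).trans (hI t ht 0)
    rw [norm_zero, zero_add] at h
    exact (div_nonneg_iff.mp h).elim (fun h => h.1) fun h => absurd h.2 (not_le.mpr hsq)
  have hbd : ∀ y, ‖u t y‖ ≤ C₀ / √(-t) := fun y =>
    (hI t ht y).trans (div_le_div_of_nonneg_left hC₀ hsq (by linarith [norm_nonneg y]))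
  have hconst := eq_of_curl_eq_zero_of_isDivFree_of_bounded hs hcurl (hsol.divFree t (mem_Iio.mpr ht)) hbd
  -- the constant value has Type-I decay in `|y|`, hence is `0`
  by_contra hx
  have hpos : 0 < ‖u t x‖ := norm_pos_iff.mpr hx
  obtain ⟨y, hy⟩ : ∃ y : EuclideanSpace ℝ (Fin 3), 2 * C₀ / ‖u t x‖ ≤ ‖y‖ := by
    obtain ⟨y, hy⟩ := NormedSpace.exists_lt_norm ℝ (EuclideanSpace ℝ (Fin 3)) (2 * C₀ / ‖u t x‖)
    exact ⟨y, hy.le⟩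
  have h1 : ‖u t x‖ ≤ C₀ / (‖y‖ + √(-t)) := by rw [hconst x y]; exact hI t ht y
  have hden : 0 < ‖y‖ + √(-t) := by linarith [norm_nonneg y]
  rw [le_div_iff₀ hden] at h1
  rw [div_le_iff₀ hpos] at hy
  nlinarith [h1, hy, hsq, hpos, norm_nonneg y, hC₀]

/-- ★★★ **FLOOR + CAP ⇒ TYPE-I LIOUVILLE**, assembled: a concavity floor and a stretching cap with the same `κ` on the
Type-I tangent peak class with constant `C₀` force every classical Type-I solution with constant `C₀` on `(−∞,0)`
to vanish identically. -/
theorem eq_zero_of_typeI_of_peak_doors {C₀ κ : ℝ}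
    (hfl : PeakConcavityFloor C₀ κ) (hcap : PeakStretchingCap C₀ κ)
    {u : ℝ → (EuclideanSpace ℝ (Fin 3)) → (EuclideanSpace ℝ (Fin 3))} {p : ℝ → (EuclideanSpace ℝ (Fin 3)) → ℝ}
    (hsol : IsClassicalNSSolutionOn (Iio 0) 1 0 u p) (hI : HasTypeIDecay C₀ u) :
    ∀ t : ℝ, t < 0 → ∀ x : EuclideanSpace ℝ (Fin 3), u t x = 0 :=
  eq_zero_of_typeI_of_peakClassEmpty (peakClassEmpty_of_concavityFloor_of_cap hfl hcap) hsol hI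

/-- **The pinch, read on the class: a LARGE peak forces near-saturation.**  With `K₃(C₀)` of PART J: on the peak
class, `(0 − (−1))ᾱ − 1 ≤ K₃/ρ̄` and `|∇ξ̄|²_F ≤ K₃/ρ̄`; so a twist floor `κ > 0` already bounds the peak height:
`PeakTwistFloor C₀ κ → ρ̄ ≤ K₃(C₀)/κ` for every member — the vorticity number of a would-be Type-I profile with
twisted peak is a priori bounded by `K₃(C₀)/κ`. -/
theorem peak_height_le_of_twistFloor (C₀ : ℝ) : ∃ K₃ : ℝ, 0 ≤ K₃ ∧ ∀ {κ : ℝ}, 0 < κ → PeakTwistFloor C₀ κ →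
    ∀ (v : ℝ → (EuclideanSpace ℝ (Fin 3)) → (EuclideanSpace ℝ (Fin 3))) (zbar : EuclideanSpace ℝ (Fin 3)),
      IsTypeITangentPeak C₀ v zbar → ‖curl (v (-1)) zbar‖ ≤ K₃ / κ := by
  obtain ⟨K₃, hK₃, hb⟩ := tangent_laplacian_curl_bound C₀
  refine ⟨K₃, hK₃, ?_⟩
  intro κ hκ hfl v zbar h
  obtain ⟨-, -, -, -, -, hii⟩ := h.record_identity
  have hne := h.2.2.2.1
  have hρ : 0 < ‖curl (v (-1)) zbar‖ := norm_pos_iff.mpr hne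
  have hM : ‖(Δ (curl (v (-1)))) zbar‖ ≤ K₃ := hb h.1 h.2.1 h.2.2.1 (-1) (by norm_num) zbar
  have hξ : ‖vorticityDirection (curl (v (-1))) zbar‖ = 1 := norm_vorticityDirection _ hne
  have hGM : -⟪vorticityDirection (curl (v (-1))) zbar, (Δ (curl (v (-1)))) zbar⟫ ≤
      ‖(Δ (curl (v (-1)))) zbar‖ := by
    have h := abs_real_inner_le_norm (vorticityDirection (curl (v (-1))) zbar) ((Δ (curl (v (-1)))) zbar)
    rw [hξ, one_mul] at h
    linarith [neg_abs_le ⟪vorticityDirection (curl (v (-1))) zbar, (Δ (curl (v (-1)))) zbar⟫]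
  have h1 := hfl v zbar h
  rw [le_div_iff₀ hκ]
  nlinarith [hii, hGM, hM, h1, hρ]

end Summit.NavierStokesRegularity.NavierStokesRegularity.Theorems.StrainDoors

end
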